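import Summits.CriticalPhenomena.PercolationContinuityZ3.Theorems.SahiConjecture
import Summits.CriticalPhenomena.PercolationContinuityZ3.Theorems.PercNearOneGluingNoHeavyLowerTailE3GroupSepLeFive

/-!
# `NoHeavyLowerTail` (crux stmt-CriticalPhenomena-4575): Sahi's `C_3` ⇒ ALL nine E3GRP rows on EVERY finite weighted graph

Support file (cell `prim-sahi`, typer; `--supports stmt-CriticalPhenomena-4575`).  Companion of
`…E3GroupSepLeFive` (the nine rows PROVED on `K_5` by a kernel-checked certificate) and of `SahiConjecture.lean`
(the obligation `SahiConjecture n` = Sahi 2008 Conj. 5, OPEN for `n ≥ 3`).  Here: the CONDITIONAL statement the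
cell's theorem (b) starts from — for every `n`, every `w : Sym2 (Fin n) → [0,1]`, every terminal tuple `t`
(distinct or not) and every row `i`, `KahnConjecture → RowHolds i w t` (`rowHolds_of_kahnConjecture`; Kahn's Conj. 5 =
`C_3` for product measures, the weakest printed hypothesis) and `SahiConjecture 3 → RowHolds i w t`
(`rowHolds_of_sahiConjecture`) — via the
dictionary `E3Ineq w A B C ↔ 0 ≤ sahiE3 (prodBernoulli w) (connEvent A) (connEvent B) (connEvent C)`
(`e3Ineq_iff_sahiE3_nonneg`) and the bridges of `Literature/Combinatorics/Sahi2008/Percolation.lean`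
(rows 0–3: three DEcreasing group separations, order dual; rows 4–8: three INcreasing group connections).
HONEST FRAMING: conditional on Sahi's conjecture; no claim on Sahi.
-/

noncomputable section

namespace Summit.CriticalPhenomena.PercolationContinuityZ3.Theorems.E3GroupSepCert

open MeasureTheory CovTransferCert
open Literature.Combinatorics.Sahi2008
open Literature.Probability.LatticeModels (prodBernoulli sahiE3 sahiE3_def)
open Literature.Probability.Percolation

variable {n : ℕ}

/-- Dictionary: the certificate seat's `E3Ineq` is `0 ≤ sahiE3` of the three events. [this work] -/
theorem e3Ineq_iff_sahiE3_nonneg (w : Sym2 (Fin n) → unitInterval) (A B C : CRel n → Bool) :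
    E3Ineq w A B C ↔ 0 ≤ sahiE3 (prodBernoulli w) (connEvent A) (connEvent B) (connEvent C) := by
  rw [E3Ineq, sahiE3_def, sub_nonneg]

/-- The event of a group separation `D[X|Y]` is decreasing. [this work] -/
theorem isLowerSet_connEvent_sep (X Y : List (Fin n)) : IsLowerSet (connEvent (sep X Y)) := by
  rw [connEvent_sep]
  intro ω ω' hle hω x hx y hy hmem
  exact hω x hx y hy (isUpperSet_openConn x y hle hmem)

/-- The event of a group connection `U[X|Y]` is increasing. [this work] -/
theorem isUpperSet_connEvent_lnk (X Y : List (Fin n)) : IsUpperSet (connEvent (lnk X Y)) := by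
  rw [connEvent_lnk]
  intro ω ω' hle hω
  obtain ⟨x, hx, y, hy, hmem⟩ := hω
  exact ⟨x, hx, y, hy, isUpperSet_openConn x y hle hmem⟩

/-- Kahn ⇒ `E3Ineq` for three decreasing connectivity events. [this work] -/
theorem e3Ineq_of_kahnConjecture_lower (hK : KahnConjecture) (w : Sym2 (Fin n) → unitInterval)
    {A B C : CRel n → Bool} (hA : IsLowerSet (connEvent A)) (hB : IsLowerSet (connEvent B))
    (hC' : IsLowerSet (connEvent C)) : E3Ineq w A B C :=
  (e3Ineq_iff_sahiE3_nonneg w A B C).2 (sahiE3_nonneg_of_kahnConjecture_lower hK w hA hB hC')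

/-- Kahn ⇒ `E3Ineq` for three increasing connectivity events. [this work] -/
theorem e3Ineq_of_kahnConjecture_upper (hK : KahnConjecture) (w : Sym2 (Fin n) → unitInterval)
    {A B C : CRel n → Bool} (hA : IsUpperSet (connEvent A)) (hB : IsUpperSet (connEvent B))
    (hC' : IsUpperSet (connEvent C)) : E3Ineq w A B C :=
  (e3Ineq_iff_sahiE3_nonneg w A B C).2 (hK (Sym2 (Fin n)) w _ _ _ hA hB hC')

/-- Kahn ⇒ a row of three group separations. [this work] -/
theorem e3Ineq_sep_of_kahnConjecture (hK : KahnConjecture) (w : Sym2 (Fin n) → unitInterval)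
    (X₁ Y₁ X₂ Y₂ X₃ Y₃ : List (Fin n)) : E3Ineq w (sep X₁ Y₁) (sep X₂ Y₂) (sep X₃ Y₃) :=
  e3Ineq_of_kahnConjecture_lower hK w (isLowerSet_connEvent_sep X₁ Y₁) (isLowerSet_connEvent_sep X₂ Y₂)
    (isLowerSet_connEvent_sep X₃ Y₃)

/-- Kahn ⇒ a row of three group connections. [this work] -/
theorem e3Ineq_lnk_of_kahnConjecture (hK : KahnConjecture) (w : Sym2 (Fin n) → unitInterval)
    (X₁ Y₁ X₂ Y₂ X₃ Y₃ : List (Fin n)) : E3Ineq w (lnk X₁ Y₁) (lnk X₂ Y₂) (lnk X₃ Y₃) :=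
  e3Ineq_of_kahnConjecture_upper hK w (isUpperSet_connEvent_lnk X₁ Y₁) (isUpperSet_connEvent_lnk X₂ Y₂)
    (isUpperSet_connEvent_lnk X₃ Y₃)

/-- **Kahn's Conjecture 5 ⇒ all nine E3GRP rows, on every finite weighted graph and every terminal tuple** (no
distinctness, any number `n` of vertices).  Compare `e3grp_five` (unconditional, `n = 5`, certificate). [this work] -/
theorem rowHolds_of_kahnConjecture (hK : KahnConjecture) (i : Fin 9) (w : Sym2 (Fin n) → unitInterval)
    (t : Tup n) : RowHolds i w t := by
  obtain ⟨o, a₁, a₂, a₃, b⟩ := t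
  fin_cases i
  · exact e3Ineq_sep_of_kahnConjecture hK w _ _ _ _ _ _
  · exact e3Ineq_sep_of_kahnConjecture hK w _ _ _ _ _ _
  · exact e3Ineq_sep_of_kahnConjecture hK w _ _ _ _ _ _
  · exact e3Ineq_sep_of_kahnConjecture hK w _ _ _ _ _ _
  · exact e3Ineq_lnk_of_kahnConjecture hK w _ _ _ _ _ _
  · exact e3Ineq_lnk_of_kahnConjecture hK w _ _ _ _ _ _
  · exact e3Ineq_lnk_of_kahnConjecture hK w _ _ _ _ _ _
  · exact e3Ineq_lnk_of_kahnConjecture hK w _ _ _ _ _ _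
  · exact e3Ineq_lnk_of_kahnConjecture hK w _ _ _ _ _ _

/-- **Sahi's `C_3` ⇒ all nine E3GRP rows**, every finite weighted graph, every terminal tuple. [this work] -/
theorem rowHolds_of_sahiConjecture (hC : SahiConjecture 3) (i : Fin 9) (w : Sym2 (Fin n) → unitInterval)
    (t : Tup n) : RowHolds i w t :=
  rowHolds_of_kahnConjecture (sahiConjecture_three_le_kahnConjecture hC) i w t

end Summit.CriticalPhenomena.PercolationContinuityZ3.Theorems.E3GroupSepCert
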